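import Mathlib
import Literature.Combinatorics.SimpleGraph.AlgebraicConnectivityJoinDecomposition
import Literature.Combinatorics.SimpleGraph.AlgebraicConnectivityCartesianProduct
import Literature.Combinatorics.SimpleGraph.HypercubeParkingFunctions
import HarnessLib

/-!
# The algebraic connectivity of the `m`-dimensional cube is `2` — Fiedler 1973, §4.4

Source (held, read at the page; VERBATIM). M. Fiedler, *Algebraic connectivity of graphs*,
Czechoslovak Math. J. 23 (98) (1973) 298–305 [Fiedler1973] (held text
`paper:doi-10-21136-cmj-1973-101168` p0008 = p. 304), §4 item **4.4**: «We have the following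
values for some types of graphs.» — a table with columns `graph | a(G) | e(G) | v(G) | bound of
4.3` and rows «path: `2(1 − cos(π/n))`», «circuit: `2(1 − cos(2π/n))`», «star: `1`», «complete
g.: `n`», «cube (`m`-dimensional): `a(G) = 2`, `e(G) = m`, `v(G) = m`, bound `2m sin²(π/2m)`».
The cube row rests on item **3.4** (p. 300, the Cartesian product: `a(G₁ × G₂) =
min(a(G₁), a(G₂))`, in the tree as `AlgebraicConnectivityCartesianProduct.algConn_boxProd`) and
`a(K_2) = 2`.

What is filed (theorems only). The `m`-cube is the tree's
`Literature.Combinatorics.SimpleGraph.BakerNorine.hypercube m` on `Fin m → Bool` (adjacent iff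
Hamming distance `1`, file `HypercubeParkingFunctions`); `a(G)` is the tree's
`hL.eigenvalues₀ ⟨|V| − 2, _⟩` of `AlgebraicConnectivity`.
* §1 `nonempty_hypercube_succ_iso_boxProd` — `Q_{m+1} ≅ K_2 □ Q_m` (split off the first bit),
  `hypercube_one_eq_top` — `Q_1 = K_2`.
* §2 **`algConn_hypercube`** — FIEDLER §4.4, cube row, column `a(G)`: `a(Q_m) = 2` for every
  `m ≥ 1`, by induction on `m` with 3.4, the iso-invariance of `a`
  (`AlgebraicConnectivityJoinDecomposition.algConn_eq_of_iso`) and `a(K_2) = 2`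
  (`algConn_of_eq_top`); corollary `hypercube_connected` (`a > 0` iff connected, §1 of the paper).
NOT CLAIMED: the columns `e(G) = v(G) = m` (edge/vertex connectivity of the cube) and the bound
of 4.3; the other rows of the table are already in the tree (`LaplacianPathSpectrum`,
`LaplacianCycleSpectrum.algConn_cycleGraph`, `FiedlerVectorTreesExamples` / star,
`AlgebraicConnectivityJoinDecomposition.algConn_of_eq_top`).
-/

namespace Literature.Combinatorics.SimpleGraph.AlgebraicConnectivityHypercube

open Finset Matrix
open BakerNorine (hypercube hypercube_adj)
open AlgebraicConnectivityJoinDecomposition (algConn_eq_of_iso algConn_of_eq_top)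
open AlgebraicConnectivityCartesianProduct (algConn_boxProd)
open AlgebraicConnectivity (algConn_pos_iff_connected)

/-! ## §1 `Q_{m+1} ≅ K_2 □ Q_m` and `Q_1 = K_2` -/

/-- The Hamming distance on `Fin (m + 1) → Bool` splits off the coordinate `0`. [folklore] -/
private theorem hammingDist_eq_ite_add_tail {m : ℕ} (v w : Fin (m + 1) → Bool) :
    hammingDist v w = (if v 0 ≠ w 0 then 1 else 0) + hammingDist (Fin.tail v) (Fin.tail w) := by
  simp only [hammingDist, Finset.card_filter, Fin.sum_univ_succ, Fin.tail]

/-- **`Q_{m+1} ≅ K_2 □ Q_m`**: splitting off the first coordinate, two binary vectors are at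
Hamming distance `1` iff they differ in the first bit and agree in the tail, or agree in the first
bit and their tails are at Hamming distance `1` — the Cartesian product of `K_2` with the
`m`-cube (the cube as an iterated product, as in Fiedler's use of 3.4 for §4.4).
[cite: Fiedler1973, §4.4 (table, row «cube (m-dimensional)»), p. 304; §3 item 3.4 (Cartesian
product), p. 300] -/
theorem nonempty_hypercube_succ_iso_boxProd (m : ℕ) :
    Nonempty (hypercube (m + 1) ≃g (⊤ : SimpleGraph Bool) □ hypercube m) := by
  refine ⟨{
    toEquiv :=
      { toFun := fun v => (v 0, Fin.tail v)
        invFun := fun p => Fin.cons p.1 p.2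
        left_inv := fun v => Fin.cons_self_tail v
        right_inv := fun p => (by simp) }
    map_rel_iff' := fun {v w} => ?_ }⟩
  simp only [Equiv.coe_fn_mk, SimpleGraph.boxProd_adj, SimpleGraph.top_adj, hypercube_adj]
  rw [hammingDist_eq_ite_add_tail, ← hammingDist_eq_zero]
  by_cases h : v 0 = w 0
  · rw [if_neg (not_not.2 h), zero_add]
    constructor
    · rintro (⟨hne, -⟩ | ⟨h1, -⟩)
      · exact absurd h hne
      · exact h1
    · intro h1
      exact Or.inr ⟨h1, h⟩
  · rw [if_pos h]
    constructor
    · rintro (⟨-, h0⟩ | ⟨-, h0⟩)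
      · rw [h0]
      · exact absurd h0 h
    · intro h1
      exact Or.inl ⟨h, by omega⟩

/-- **`Q_1 = K_2`**: two distinct vectors of length `1` are at Hamming distance `1`.
[cite: Fiedler1973, §4.4 (table), p. 304] -/
theorem hypercube_one_eq_top : hypercube 1 = (⊤ : SimpleGraph (Fin 1 → Bool)) := by
  ext v w
  rw [hypercube_adj, SimpleGraph.top_adj]
  constructor
  · intro h hvw
    rw [hvw, hammingDist_self] at h
    exact zero_ne_one h
  · intro hvw
    have h1 : hammingDist v w ≤ 1 := by
      have := hammingDist_le_card_fintype (x := v) (y := w)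
      simpa using this
    have h2 : hammingDist v w ≠ 0 := by
      rw [Ne, hammingDist_eq_zero]
      exact hvw
    omega

/-- `|V(Q_m)| = 2^m`. [folklore] -/
private theorem card_vertices (m : ℕ) : Fintype.card (Fin m → Bool) = 2 ^ m := by
  simp

/-- `|V(Q_m)| ≥ 2` for `m ≥ 1`. [folklore] -/
private theorem two_le_card_vertices {m : ℕ} (hm : 1 ≤ m) : 2 ≤ Fintype.card (Fin m → Bool) := by
  rw [card_vertices]
  calc 2 = 2 ^ 1 := by norm_num
    _ ≤ 2 ^ m := Nat.pow_le_pow_right (by norm_num) hm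

/-! ## §2 `a(Q_m) = 2` -/

/-- **FIEDLER 1973, §4.4: «We have the following values for some types of graphs … cube
(`m`-dimensional): `a(G) = 2`»** (`m ≥ 1`; the table also lists `e(G) = v(G) = m`). Proof by
induction along `Q_{m+1} ≅ K_2 □ Q_m` with 3.4, `a(G₁ × G₂) = min(a(G₁), a(G₂))` (the tree's
`AlgebraicConnectivityCartesianProduct.algConn_boxProd`), `a(K_2) = 2`, and `Q_1 = K_2`.
[cite: Fiedler1973, §4.4 (table, row «cube (m-dimensional)», column `a(G)`), p. 304] -/
theorem algConn_hypercube : ∀ {m : ℕ} (hm : 1 ≤ m) [DecidableRel (hypercube m).Adj]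
    (hL : ((hypercube m).lapMatrix ℝ).IsHermitian),
    hL.eigenvalues₀ ⟨Fintype.card (Fin m → Bool) - 2,
      Nat.sub_lt (by have := two_le_card_vertices hm; omega) two_pos⟩ = 2
  | 0, hm, _, _ => absurd hm (by omega)
  | 1, _, _, hL => by
    -- `Q_1 = K_2` on `2` vertices
    have h := algConn_of_eq_top (hypercube 1) (two_le_card_vertices le_rfl) hL
      hypercube_one_eq_top
    rw [h, card_vertices]
    norm_num
  | m + 2, _, _, hL => by
    classical
    have hm' : 1 ≤ m + 1 := by omega
    obtain ⟨e⟩ := nonempty_hypercube_succ_iso_boxProd (m + 1)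
    have hQ : ((hypercube (m + 1)).lapMatrix ℝ).IsHermitian :=
      SimpleGraph.isHermitian_lapMatrix _ _
    have hT : ((⊤ : SimpleGraph Bool).lapMatrix ℝ).IsHermitian :=
      SimpleGraph.isHermitian_lapMatrix _ _
    have hP : (((⊤ : SimpleGraph Bool) □ hypercube (m + 1)).lapMatrix ℝ).IsHermitian :=
      SimpleGraph.isHermitian_lapMatrix _ _
    have hcard : 2 ≤ Fintype.card (Fin (m + 2) → Bool) := two_le_card_vertices (by omega)
    rw [← algConn_eq_of_iso e hcard hL hP, algConn_boxProd ⊤ (hypercube (m + 1)) (by simp)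
      (two_le_card_vertices hm') hT hQ hP, algConn_hypercube hm' hQ,
      algConn_of_eq_top (⊤ : SimpleGraph Bool) (by simp) hT rfl]
    simp

/-- **The `m`-cube is connected** (`a(Q_m) = 2 > 0`, and «`a(G)` is zero if and only if `G` is
not connected»; `Q_0` is a single vertex). [cite: Fiedler1973, §4.4 with §1, pp. 298, 304] -/
theorem hypercube_connected (m : ℕ) : (hypercube m).Connected := by
  classical
  rcases Nat.eq_zero_or_pos m with rfl | hm
  · haveI : Subsingleton (Fin 0 → Bool) := inferInstance
    exact SimpleGraph.Connected.mk (fun v w => by rw [Subsingleton.elim v w])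
  · have hL : ((hypercube m).lapMatrix ℝ).IsHermitian := SimpleGraph.isHermitian_lapMatrix _ _
    have h := algConn_hypercube hm hL
    exact (algConn_pos_iff_connected (hypercube m) (two_le_card_vertices hm) hL).1 (by
      rw [h]; norm_num)

end Literature.Combinatorics.SimpleGraph.AlgebraicConnectivityHypercube
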